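import Literature.MathematicalPhysics.QuantumFieldTheory.Balaban1983to89.T3UnitLawDensityEML
import Literature.MathematicalPhysics.QuantumFieldTheory.Balaban1983to89.B10Eq6DensityLevel
import HarnessLib

/-!
# (Z-LOW-PROV) — THE PARTITION-FUNCTION LOWER BOUND FROM AN (A.E.) LOWER BOUND ON A WINDOW + THE WINDOW's HAAR VOLUME, AND ITS K-UNIFORM
# INSTANCE ON THE SMALL-FIELD DOMAIN (4) OF THE UNIT LATTICE

Cell `ym3-torus` (YM ladder rung R3 = continuum `SU(2)` Yang–Mills on the three-torus — a RUNG, NOT d = 4, NOT infinite volume, NOT a mass gap,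
NOT Clay).  Width seat `ym3-torus-px12` (gen 12; p1-lineage purpose = the UV3 node of [Balaban1985UV3]); `--supports stmt-QuantumFields-19936 --as helper`,
count-neutral, definition-free, default heartbeats.  Spec = `ym3-torus-px13` g11's (Z-LOW-PROV) row (bus 2026-08-29 20:27:01Z) = the last line of the
S-low slot `hLOW` of the Z-DOOR ✓`Summit.QuantumFields.YangMills.Theorems.UV3PinnedRatioOfTowerBounds` («pinned (41)» programme, ★★OWNER WORD 47 (iii)(α));
the A.E. forms follow px13 g11's Z-DOOR v2.1 ruling (the tree's tower `emlDensity` is a Radon–Nikodym VERSION, so density-level slots are a.e. statements).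

THE POINT.  [Balaban1985UV3] proves the LOWER half of its UV-stability bound (5)∕(47) on the small-field window `χ_K` (p. 256 (5):
`χ(U)·exp[−g_K⁻²A^η(U_K(U)) − O(1)|T₁^{(K)}|] ≤ ρ_K(U)`) and turns it into a bound on the partition function `∫ρ_K` ((6) p. 257: «The bounds (5) imply bounds for
partition functions») by integrating over the window, whose product-Haar volume is bounded below.  The lit lane typed that sentence for ITS carrier
(`B10Eq6DensityLevel.integral_ge_of_lower` ∕ `partitionFn_ge`: floor `e^{−c}` on the domain (4), volume `haar{dist1 < δ}^{#bonds}`).  THIS FILE types the same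
integration step for the cell's CONSTRUCTED tower `ρ_k := T3UnitLawDensityEML.emlDensity F γ K k` (non-negative, integrable in the standing range `k ≤ m + K`):
* §1 `integral_ge_mul_of_window_ae` ∕ `integral_ge_mul_of_window` — generic: `0 ≤ ρ` integrable on a finite measure space, `ℓ ≤ ρ` (a.e.) on a measurable window `W`,
  `0 ≤ ℓ`, `v ≤ μ.real W` ⟹ `ℓ·v ≤ ∫ρ`;
* §2 ★★ `integral_emlDensity_ge_of_window` (px13's displayed text, pointwise floor) and its a.e. twin `…_ae`; ★ `exp_le_integral_emlDensity_of_window(_ae)` — the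
  exponential form docking into the Z-DOOR's `hLOW : Real.exp (−E − Cl) ≤ ∫ ρ_k` with `Cl := Cl' + Cv'`; ★ `anchor_mul_exp_le_integral_emlDensity_of_window(_ae)` — the
  multiplicative-anchor form (`Λ·e^{−Cl} ≤ ∫ρ_k`, any anchor `Λ ≥ 0`) of the anchored door ✓-to-be `…UV3PinnedRatioOfTowerBoundsAnchored`;
* §3 ★★ `exp_le_integral_emlDensity_top_of_plaqSmall_floor_ae` — THE K-UNIFORM INSTANCE ON THE DOMAIN (4) OF THE UNIT LATTICE: for a family `F` and a radius
  `ε₁ > 0` there is ONE `Cv` (after `F, ε₁`; before `K`) such that for EVERY run `K` and every `c`, an a.e. floor `e^{−c} ≤ ρ_K` on `{PlaqSmall ε₁}` of the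
  level-`K` (unit) lattice gives `e^{−(c + Cv)} ≤ ∫ ρ_K dV_K` — via lit `B10Eq6DensityLevel.bondSmall_subset_plaqSmall` ∕ `fieldMeasure_bondSmall` ∕
  `haar_dist1Lt_pos_specialUnitaryGroup` and `card_pbond_top` (`#bonds(T₁^{(K)}) = 3·(2L^m)³`, independent of `K`; lit `B10StarCount.card_pbond` pattern).  This is S-low's shape «`∃ Cl, ∀ K, …`» modulo
  the (47)∕(5)_K floor itself (UV3-node Tier A-2), which stays DISPLAYED.

HONEST SCOPE.  Measure-theoretic bookkeeping (monotonicity of the set integral, product-Haar volume of a product window); the floor on the window and, in §1–§2,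
the window volume are DISPLAYED hypotheses, asserted for nothing; nothing of (Z-LOW), (Z-UP-PIN), S-step, `stub_pinnedRatio`, `HistoryTailL` (19936) or the rung is
proved here.  Sorry-free, axioms standard.

References: T. Bałaban, *Ultraviolet stability of three-dimensional lattice pure gauge field theories*, Commun. Math. Phys. **102** (1985) 255–275
[Balaban1985UV3] ((4)–(5) p.256, (6) p.257, (47) p.267).
-/

set_option autoImplicit false

noncomputable section

open MeasureTheory
open Literature.MathematicalPhysics.QuantumFieldTheory.Balaban1983to89
open Literature.MathematicalPhysics.QuantumFieldTheory.Balaban1983to89.T3ContinuumYM3Torus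
open Literature.MathematicalPhysics.QuantumFieldTheory.Balaban1983to89.T3UnitLawDensityEML

namespace Summit.QuantumFields.YangMills.Theorems.UV3PartitionLowerOfWindow

/-! ## §1 The generic integration step -/

/-- **An a.e. floor on a window integrates**: on a finite measure space, if `0 ≤ ρ` is integrable, `ℓ ≤ ρ` a.e. on a measurable window `W`, `0 ≤ ℓ`
and `v ≤ μ.real W`, then `ℓ·v ≤ ∫ ρ dμ` ((6) p. 257 «The bounds (5) imply bounds for partition functions» — its lower half, abstractly).
[cite: Balaban1985UV3, (6) p.257] -/
theorem integral_ge_mul_of_window_ae {α : Type*} [MeasurableSpace α] (μ : Measure α) [IsFiniteMeasure μ]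
    {ρ : α → ℝ} (hρ0 : ∀ x, 0 ≤ ρ x) (hρi : Integrable ρ μ)
    {W : Set α} (hW : MeasurableSet W) {ℓ v : ℝ} (hℓ : 0 ≤ ℓ) (hv : v ≤ μ.real W)
    (hlow : ∀ᵐ x ∂μ, x ∈ W → ℓ ≤ ρ x) :
    ℓ * v ≤ ∫ x, ρ x ∂μ := by
  calc ℓ * v ≤ ℓ * μ.real W := mul_le_mul_of_nonneg_left hv hℓ
    _ = ∫ _ in W, ℓ ∂μ := by rw [setIntegral_const, smul_eq_mul, mul_comm]
    _ ≤ ∫ x in W, ρ x ∂μ :=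
        setIntegral_mono_on_ae (integrable_const ℓ).integrableOn hρi.integrableOn hW hlow
    _ ≤ ∫ x, ρ x ∂μ := setIntegral_le_integral hρi (Filter.Eventually.of_forall hρ0)

/-- **A pointwise floor on a window integrates** (the everywhere form of `integral_ge_mul_of_window_ae`). [cite: Balaban1985UV3, (6) p.257] -/
theorem integral_ge_mul_of_window {α : Type*} [MeasurableSpace α] (μ : Measure α) [IsFiniteMeasure μ]
    {ρ : α → ℝ} (hρ0 : ∀ x, 0 ≤ ρ x) (hρi : Integrable ρ μ)
    {W : Set α} (hW : MeasurableSet W) {ℓ v : ℝ} (hℓ : 0 ≤ ℓ) (hv : v ≤ μ.real W)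
    (hlow : ∀ x ∈ W, ℓ ≤ ρ x) :
    ℓ * v ≤ ∫ x, ρ x ∂μ :=
  integral_ge_mul_of_window_ae μ hρ0 hρi hW hℓ hv (Filter.Eventually.of_forall hlow)

/-! ## §2 The step for the constructed renormalised densities `ρ_k = emlDensity F γ K k` against product Haar -/

variable (F : T3Family) {γ : ℝ}

/-- ★★ **(Z-LOW-PROV)**: for the CONSTRUCTED renormalised density `ρ_k = emlDensity F γ K k` of the `K`-th approximation (`0 ≤ γ`, standing range
`k ≤ m + K`), a pointwise floor `ℓ ≥ 0` on a measurable window `W` of product-Haar volume `≥ v` gives `ℓ·v ≤ ∫ ρ_k dV` — the integration step of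
[Balaban1985UV3] (5) ⇒ (6) (lower half), with the floor and the volume DISPLAYED. [cite: Balaban1985UV3, (5) p.256, (6) p.257, (47) p.267] -/
theorem integral_emlDensity_ge_of_window (hγ : 0 ≤ γ) (K k : ℕ) (hk : k ≤ F.m + K)
    (W : Set (GaugeField (F.P K) k (Matrix.specialUnitaryGroup (Fin 2) ℂ))) (hW : MeasurableSet W)
    {ℓ v : ℝ} (hℓ : 0 ≤ ℓ)
    (hv : v ≤ (fieldMeasure (F.P K) k (Matrix.specialUnitaryGroup (Fin 2) ℂ)).real W)
    (hlow : ∀ V ∈ W, ℓ ≤ emlDensity F γ K k V) :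
    ℓ * v ≤ ∫ V, emlDensity F γ K k V ∂fieldMeasure (F.P K) k (Matrix.specialUnitaryGroup (Fin 2) ℂ) :=
  integral_ge_mul_of_window _ (emlDensity_nonneg F γ K k) (integrable_emlDensity F K hγ k hk) hW hℓ hv hlow

/-- ★★ **(Z-LOW-PROV), A.E. FLOOR** — the honest currency for the Radon–Nikodym version `ρ_k` (px13 g11, Z-DOOR v2.1): a floor `ℓ ≤ ρ_k` holding
`dV`-a.e. on the window suffices. [cite: Balaban1985UV3, (5) p.256, (6) p.257, (47) p.267] -/
theorem integral_emlDensity_ge_of_window_ae (hγ : 0 ≤ γ) (K k : ℕ) (hk : k ≤ F.m + K)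
    (W : Set (GaugeField (F.P K) k (Matrix.specialUnitaryGroup (Fin 2) ℂ))) (hW : MeasurableSet W)
    {ℓ v : ℝ} (hℓ : 0 ≤ ℓ)
    (hv : v ≤ (fieldMeasure (F.P K) k (Matrix.specialUnitaryGroup (Fin 2) ℂ)).real W)
    (hlow : ∀ᵐ V ∂fieldMeasure (F.P K) k (Matrix.specialUnitaryGroup (Fin 2) ℂ), V ∈ W → ℓ ≤ emlDensity F γ K k V) :
    ℓ * v ≤ ∫ V, emlDensity F γ K k V ∂fieldMeasure (F.P K) k (Matrix.specialUnitaryGroup (Fin 2) ℂ) :=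
  integral_ge_mul_of_window_ae _ (emlDensity_nonneg F γ K k) (integrable_emlDensity F K hγ k hk) hW hℓ hv hlow

/-- ★ **Exponential form, docking into the Z-DOOR's `hLOW`**: from `exp(−E − Cl') ≤ ρ_k` on the window and `exp(−Cv') ≤ Haar(W)`,
`exp(−E − (Cl' + Cv')) ≤ ∫ ρ_k dV` (so `hLOW` holds with `Cl := Cl' + Cv'`). [cite: Balaban1985UV3, (5) p.256, (6) p.257, (47) p.267] -/
theorem exp_le_integral_emlDensity_of_window (hγ : 0 ≤ γ) (K k : ℕ) (hk : k ≤ F.m + K)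
    (W : Set (GaugeField (F.P K) k (Matrix.specialUnitaryGroup (Fin 2) ℂ))) (hW : MeasurableSet W)
    {E Cl' Cv' : ℝ}
    (hv : Real.exp (-Cv') ≤ (fieldMeasure (F.P K) k (Matrix.specialUnitaryGroup (Fin 2) ℂ)).real W)
    (hlow : ∀ V ∈ W, Real.exp (-E - Cl') ≤ emlDensity F γ K k V) :
    Real.exp (-E - (Cl' + Cv')) ≤ ∫ V, emlDensity F γ K k V ∂fieldMeasure (F.P K) k (Matrix.specialUnitaryGroup (Fin 2) ℂ) := by
  have h := integral_emlDensity_ge_of_window F hγ K k hk W hW (Real.exp_pos _).le hv hlow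
  have e : Real.exp (-E - (Cl' + Cv')) = Real.exp (-E - Cl') * Real.exp (-Cv') := by
    rw [← Real.exp_add]; ring_nf
  rw [e]; exact h

/-- ★ **Exponential form, a.e. floor.** [cite: Balaban1985UV3, (5) p.256, (6) p.257, (47) p.267] -/
theorem exp_le_integral_emlDensity_of_window_ae (hγ : 0 ≤ γ) (K k : ℕ) (hk : k ≤ F.m + K)
    (W : Set (GaugeField (F.P K) k (Matrix.specialUnitaryGroup (Fin 2) ℂ))) (hW : MeasurableSet W)
    {E Cl' Cv' : ℝ}
    (hv : Real.exp (-Cv') ≤ (fieldMeasure (F.P K) k (Matrix.specialUnitaryGroup (Fin 2) ℂ)).real W)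
    (hlow : ∀ᵐ V ∂fieldMeasure (F.P K) k (Matrix.specialUnitaryGroup (Fin 2) ℂ),
      V ∈ W → Real.exp (-E - Cl') ≤ emlDensity F γ K k V) :
    Real.exp (-E - (Cl' + Cv')) ≤ ∫ V, emlDensity F γ K k V ∂fieldMeasure (F.P K) k (Matrix.specialUnitaryGroup (Fin 2) ℂ) := by
  have h := integral_emlDensity_ge_of_window_ae F hγ K k hk W hW (Real.exp_pos _).le hv hlow
  have e : Real.exp (-E - (Cl' + Cv')) = Real.exp (-E - Cl') * Real.exp (-Cv') := by
    rw [← Real.exp_add]; ring_nf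
  rw [e]; exact h

/-- ★ **Multiplicative-anchor form** (the `hLOW : Λ·cl ≤ ∫ρ_k` slot of the anchored door): for an anchor `Λ ≥ 0`, from `Λ·exp(−Cl') ≤ ρ_k` on the window and
`exp(−Cv') ≤ Haar(W)`, `Λ·exp(−(Cl' + Cv')) ≤ ∫ ρ_k dV`. [cite: Balaban1985UV3, (5) p.256, (6) p.257, (47) p.267] -/
theorem anchor_mul_exp_le_integral_emlDensity_of_window (hγ : 0 ≤ γ) (K k : ℕ) (hk : k ≤ F.m + K)
    (W : Set (GaugeField (F.P K) k (Matrix.specialUnitaryGroup (Fin 2) ℂ))) (hW : MeasurableSet W)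
    {Λ Cl' Cv' : ℝ} (hΛ : 0 ≤ Λ)
    (hv : Real.exp (-Cv') ≤ (fieldMeasure (F.P K) k (Matrix.specialUnitaryGroup (Fin 2) ℂ)).real W)
    (hlow : ∀ V ∈ W, Λ * Real.exp (-Cl') ≤ emlDensity F γ K k V) :
    Λ * Real.exp (-(Cl' + Cv')) ≤ ∫ V, emlDensity F γ K k V ∂fieldMeasure (F.P K) k (Matrix.specialUnitaryGroup (Fin 2) ℂ) := by
  have h := integral_emlDensity_ge_of_window F hγ K k hk W hW (mul_nonneg hΛ (Real.exp_pos _).le) hv hlow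
  have e : Λ * Real.exp (-(Cl' + Cv')) = Λ * Real.exp (-Cl') * Real.exp (-Cv') := by
    rw [mul_assoc, ← Real.exp_add]; ring_nf
  rw [e]; exact h

/-- ★ **Multiplicative-anchor form, a.e. floor.** [cite: Balaban1985UV3, (5) p.256, (6) p.257, (47) p.267] -/
theorem anchor_mul_exp_le_integral_emlDensity_of_window_ae (hγ : 0 ≤ γ) (K k : ℕ) (hk : k ≤ F.m + K)
    (W : Set (GaugeField (F.P K) k (Matrix.specialUnitaryGroup (Fin 2) ℂ))) (hW : MeasurableSet W)
    {Λ Cl' Cv' : ℝ} (hΛ : 0 ≤ Λ)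
    (hv : Real.exp (-Cv') ≤ (fieldMeasure (F.P K) k (Matrix.specialUnitaryGroup (Fin 2) ℂ)).real W)
    (hlow : ∀ᵐ V ∂fieldMeasure (F.P K) k (Matrix.specialUnitaryGroup (Fin 2) ℂ),
      V ∈ W → Λ * Real.exp (-Cl') ≤ emlDensity F γ K k V) :
    Λ * Real.exp (-(Cl' + Cv')) ≤ ∫ V, emlDensity F γ K k V ∂fieldMeasure (F.P K) k (Matrix.specialUnitaryGroup (Fin 2) ℂ) := by
  have h := integral_emlDensity_ge_of_window_ae F hγ K k hk W hW (mul_nonneg hΛ (Real.exp_pos _).le) hv hlow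
  have e : Λ * Real.exp (-(Cl' + Cv')) = Λ * Real.exp (-Cl') * Real.exp (-Cv') := by
    rw [mul_assoc, ← Real.exp_add]; ring_nf
  rw [e]; exact h

/-! ## §3 The K-uniform instance on the small-field domain (4) of the unit lattice `T₁^{(K)}` -/

/-- **The unit lattice has the same size in every approximation**: `#bonds(T₁^{(K)}) = 3·(2L^m)³` for the level-`K` torus of the `K`-th approximation
(`sitesPerDir K = 2L^m`, three directions). [cite: Balaban1985UV3, (1)–(3) p.256] -/
theorem card_pbond_top (K : ℕ) :
    Fintype.card (PBond (F.P K) K) = (2 * F.L ^ F.m) ^ 3 * 3 := by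
  have hd : (F.P K).d = 3 := T3Family.P_d F K
  have hsp : (F.P K).sitesPerDir K = 2 * F.L ^ F.m := by
    simp [Params.sitesPerDir]
  have hsite : Fintype.card (Site (F.P K) K) = (2 * F.L ^ F.m) ^ 3 := by
    rw [show Fintype.card (Site (F.P K) K) = Fintype.card (Fin (F.P K).d → ZMod ((F.P K).sitesPerDir K)) from rfl,
      Fintype.card_pi, Finset.prod_const, Finset.card_univ, ZMod.card, hsp, Fintype.card_fin, hd]
  rw [Fintype.card_congr (⟨fun b => (b.src, b.dir), fun p => ⟨p.1, p.2⟩, fun _ => rfl, fun _ => rfl⟩ :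
      PBond (F.P K) K ≃ Site (F.P K) K × Fin (F.P K).d), Fintype.card_prod, hsite, Fintype.card_fin, hd]

/-- ★★ **S-LOW's SHAPE ON THE DOMAIN (4), K-UNIFORM, MODULO THE (47)∕(5)_K FLOOR**: for a family `F` (`0 ≤ γ`) and a window radius `ε₁ > 0` there is ONE constant
`Cv` — chosen after `F, ε₁` and BEFORE the run `K` — such that for every `K` and every `c`, an a.e. floor `e^{−c} ≤ ρ_K` on the small-field domain
`{V | PlaqSmall ε₁ V}` of the unit lattice `T₁^{(K)}` gives `e^{−(c + Cv)} ≤ ∫ ρ_K dV_K` (`= Z_K` by (6)).  `e^{−Cv} = haar{dist1 < ε₁∕4}^{3(2L^m)³}` (lit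
`B10Eq6DensityLevel.fieldMeasure_bondSmall` ∕ `bondSmall_subset_plaqSmall` ∕ `haar_dist1Lt_pos_specialUnitaryGroup`, and `card_pbond_top`).
[cite: Balaban1985UV3, (4)–(5) p.256, (6) p.257, (47) p.267] -/
theorem exp_le_integral_emlDensity_top_of_plaqSmall_floor_ae (hγ : 0 ≤ γ) {ε₁ : ℝ} (hε₁ : 0 < ε₁) :
    ∃ Cv : ℝ, ∀ (K : ℕ) (c : ℝ),
      (∀ᵐ V ∂fieldMeasure (F.P K) K (Matrix.specialUnitaryGroup (Fin 2) ℂ),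
          PlaqSmall ε₁ V → Real.exp (-c) ≤ emlDensity F γ K K V) →
        Real.exp (-(c + Cv)) ≤ ∫ V, emlDensity F γ K K V ∂fieldMeasure (F.P K) K (Matrix.specialUnitaryGroup (Fin 2) ℂ) := by
  -- the one-bond window and its Haar mass `m ∈ (0, 1]`
  haveI : IsProbabilityMeasure (HaarData.haar : Measure (Matrix.specialUnitaryGroup (Fin 2) ℂ)) := HaarData.isProb
  set m : ℝ := ((HaarData.haar : Measure (Matrix.specialUnitaryGroup (Fin 2) ℂ))
    {g : Matrix.specialUnitaryGroup (Fin 2) ℂ | dist1 g < ε₁ / 4}).toReal with hm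
  have hδ : 0 < ε₁ / 4 := by linarith
  have hmpos : 0 < m :=
    ENNReal.toReal_pos (B10Eq6DensityLevel.haar_dist1Lt_pos_specialUnitaryGroup (n := Fin 2) hδ).ne' (measure_ne_top _ _)
  refine ⟨-(((2 * F.L ^ F.m) ^ 3 * 3 : ℕ) : ℝ) * Real.log m, fun K c hlow => ?_⟩
  -- the product window `bondSmall (ε₁/4) ⊆ {PlaqSmall ε₁}` and its volume `m^{#bonds}`
  set W : Set (GaugeField (F.P K) K (Matrix.specialUnitaryGroup (Fin 2) ℂ)) :=
    B10Eq6DensityLevel.bondSmall (F.P K) (Matrix.specialUnitaryGroup (Fin 2) ℂ) K (ε₁ / 4) with hWdef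
  have hWm : MeasurableSet W :=
    B10Eq6DensityLevel.measurableSet_bondSmall K (B10Eq6DensityLevel.measurableSet_dist1Lt (ε₁ / 4))
  have hWsub : W ⊆ {V | PlaqSmall ε₁ V} := by
    intro V hV
    exact B10Eq6DensityLevel.bondSmall_subset_plaqSmall (P := F.P K) (G := Matrix.specialUnitaryGroup (Fin 2) ℂ)
      (by linarith : 4 * (ε₁ / 4) ≤ ε₁) hV
  have hvol : (fieldMeasure (F.P K) K (Matrix.specialUnitaryGroup (Fin 2) ℂ)).real W = m ^ ((2 * F.L ^ F.m) ^ 3 * 3) := by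
    rw [measureReal_def, hWdef, B10Eq6DensityLevel.fieldMeasure_bondSmall, ENNReal.toReal_pow, card_pbond_top]
  have hlowW : ∀ᵐ V ∂fieldMeasure (F.P K) K (Matrix.specialUnitaryGroup (Fin 2) ℂ),
      V ∈ W → Real.exp (-c) ≤ emlDensity F γ K K V :=
    hlow.mono fun V hV hVW => hV (hWsub hVW)
  have h := integral_emlDensity_ge_of_window_ae F hγ K K (Nat.le_add_left K F.m) W hWm (Real.exp_pos _).le hvol.symm.le hlowW
  -- `e^{−(c + Cv)} = e^{−c} · m^{#bonds}`
  have e : Real.exp (-(c + -(((2 * F.L ^ F.m) ^ 3 * 3 : ℕ) : ℝ) * Real.log m)) =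
      Real.exp (-c) * m ^ ((2 * F.L ^ F.m) ^ 3 * 3) := by
    rw [show -(c + -(((2 * F.L ^ F.m) ^ 3 * 3 : ℕ) : ℝ) * Real.log m) =
        -c + (((2 * F.L ^ F.m) ^ 3 * 3 : ℕ) : ℝ) * Real.log m by ring, Real.exp_add, ← Real.log_pow,
      Real.exp_log (pow_pos hmpos _)]
  rw [e]
  exact h

end Summit.QuantumFields.YangMills.Theorems.UV3PartitionLowerOfWindow

end
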